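import Summits.ResolutionOfSingularities.ResolutionOfSingularities.Theorems.FrobeniusClosingSteerNonRationalStepNotIsolatedPrelims
import Summits.ResolutionOfSingularities.ResolutionOfSingularities.Theorems.FrobeniusClosingSteerNonRationalStepContraction
import Summits.ResolutionOfSingularities.ResolutionOfSingularities.Theorems.FrobeniusClosingSteerNonRationalStepTransversalDerivation
import Summits.ResolutionOfSingularities.ResolutionOfSingularities.Theorems.FrobeniusClosingSteerNonRationalStepTransversalReading
import Summits.ResolutionOfSingularities.ResolutionOfSingularities.Theorems.FrobeniusClosingSteerNonRationalStepVerticalReading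
import Summits.ResolutionOfSingularities.ResolutionOfSingularities.Theorems.WildConesCampaignW46FormalChartLe
import HarnessLib

/-!
# Crux `Steer` (stmt-ResolutionOfSingularities-16345), chain W4.1 — K-I2 FILE H (part 2 of 2): **THE I″ KERNEL
# `nonRationalStepNotIsolated_holds`** (`LemmaI.NonRationalStepNotIsolated d` HOLDS for every even `d`)

OURS (campaign `res-hironaka`, rung L ★L-G4, slot W4.1; res-L0-w41-idea-3 blueprint `K-I2-BLUEPRINT.md` ae0581fa150ab9c1 / signatures
`K-I2_signatures.lean` e62c805738af0a97 §FILE H; res-L0-w41-plan-1 RULING 274 (a)). Candidates, not facts; nothing here is a statement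
of H. Hironakaʼs manuscript [Hironaka2017] (status: under review). AI-written; AI review is weaker than expert review. Theses-free and
definition-free: the statement is the BODY of res-L0-w41-idea-3's `LemmaISketch.lean` e24d0b6d59dcc758 l.70–92
(`NonRationalStepNotIsolated d`) VERBATIM; it is consumed at `d := 2e` as the binder `hI2` of `GeomAssembly.geomChain_false_of_pieces`.

THE STATEMENT. A quadratic transform `S₀ → S₁` of 3-dimensional regular local rings inside a field `L` of characteristic `2` (`S₁`
excellent), exceptional parameter `x₀` (`𝔪₀S₁ = (x₀)`), the order-`2` law `f₁·x₀^d = f₀ − g₀²` with `d` even, a CLEANING `f₁ − g₁² ∈ 𝔪₁^d`,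
an `𝔪`-independent family `u₁, …, u_q ∈ S₁` over `S₀`, a curve germ `(x₀, w)` (prime, regular, 1-dimensional quotient) with `G = w·x₀^δ`,
`G ∈ 𝔪₀^δ`, and the numerical room `δ(d+1) < q(d−1)` force `S₁[√f₁] = RadicandRing S₁ 2 f₁` to have a NON-ISOLATED singularity.

THE PROOF (blueprint §0). Test `F̂₁ := frame(f̂₁) ∈ A = K′⟦X₀, X₁, X₂⟧` (Cohen frame of `Ŝ₁` adapted to `(x₀, w, t)`) against ALL
derivations of `A` over `ℤ`: every derivation takes (a unit-square multiple of) `F̂₁` into `(X₀, X₁)` — by the VERTICAL READING (FILE F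
`vertical_apply_mem`, through the chart `Θ : B = S₀[𝔪₀/X] → κ₀[T, U]` and the key lemma FILE B) for the part killing the transversal
direction, and by the TRANSVERSAL READING (FILE G `transversal_apply_mem`: local Bezout FILE A, the transversal derivation FILE E, the
contraction FILE D) for the rest; the closing move (prelims `not_hasIsolatedSingularity_of_forall_derivation`: formal square criterion
FILE C + persistent arc + excellent descent) concludes.
[cite: Matsumura1987, Thm. 14.2, Thm. 28.3, Thm. 30.5, Thm. 30.6] [cite: Cutkosky2014, §2.1] [folklore]
-/

noncomputable section

set_option linter.dupNamespace false

open IsLocalRing Module MvPolynomial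

namespace Summit.ResolutionOfSingularities.ResolutionOfSingularities.Theorems.SwitchingDichotomy.LemmaI2

open Literature.AlgebraicGeometry.Resolution
open Summit.ResolutionOfSingularities.ResolutionOfSingularities.Theorems.SwitchingDichotomy.Words

/-! ## The I″ kernel -/

set_option maxHeartbeats 1600000 in
/-- **The I″ kernel (`NonRationalStepNotIsolated d` holds).** The statement is the body of res-L0-w41-idea-3's
`def NonRationalStepNotIsolated (d : ℕ)` (`LemmaISketch.lean` e24d0b6d59dcc758 l.70–92) VERBATIM. OURS; replaces the role of no printed item;
NOT a statement of the manuscript under review. [cite: Matsumura1987, Thm. 14.2, Thm. 28.3, Thm. 30.6] [cite: Cutkosky2014, §2.1] [folklore] -/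
theorem nonRationalStepNotIsolated_holds (d : ℕ) :
    ∀ (L : Type) [Field L] [CharP L 2]
    (S₀ S₁ : Subring L) [IsLocalRing S₀] [IsLocalRing S₁] (h₀₁ : S₀ ≤ S₁)
    (f₀ g₀ G : S₀) (f₁ x₀ w : S₁) (q δ : ℕ) (u : Fin q → S₁),
    IsRegularLocalRing S₀ → IsRegularLocalRing S₁ → IsExcellentRing S₁ →
    ringKrullDim S₀ = 3 → ringKrullDim S₁ = 3 →
    IsQuadraticTransform S₀ S₁ →
    Ideal.span ((fun y : S₀ => (⟨(y : L), h₀₁ y.2⟩ : S₁)) '' (maximalIdeal S₀ : Set S₀)) = Ideal.span {x₀} →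
    Even d →
    ((f₁ : S₁) : L) * ((x₀ : S₁) : L) ^ d = ((f₀ : S₀) : L) - ((g₀ : S₀) : L) ^ 2 →
    (∃ g₁ : S₁, f₁ - g₁ ^ 2 ∈ maximalIdeal S₁ ^ d) →
    (∀ a : Fin q → S₀, (∑ i, (⟨((a i : S₀) : L), h₀₁ (a i).2⟩ : S₁) * u i) ∈ maximalIdeal S₁ →
      ∀ i, a i ∈ maximalIdeal S₀) →
    G ∈ maximalIdeal S₀ ^ δ → ((G : S₀) : L) = ((w : S₁) : L) * ((x₀ : S₁) : L) ^ δ →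
    (Ideal.span ({x₀, w} : Set S₁)).IsPrime →
    IsRegularLocalRing (S₁ ⧸ Ideal.span ({x₀, w} : Set S₁)) →
    ringKrullDim (S₁ ⧸ Ideal.span ({x₀, w} : Set S₁)) = 1 →
    δ * (d + 1) < q * (d - 1) →
    ¬ HasIsolatedSingularity (RadicandRing S₁ 2 f₁) := by
  intro L _ _ S₀ S₁ _ _ h₀₁ f₀ g₀ G f₁ x₀ w q δ u hreg₀ hreg₁ hexc hdim₀ hdim₁ hQT hx₀ hev hlaw hclean hindep hGδ hGw hWp
    hWreg hWdim hstar
  classical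
  haveI := hreg₀
  haveI := hreg₁
  haveI := hWp
  obtain ⟨_, X, hX, hX0, _, hB, -, hdom⟩ := id hQT
  /- ### Step 1: a regular system of parameters `z = (X, Y, Z)` of `S₀`; the chart `B = S₀[𝔪₀/X] ⊆ S₁`. -/
  have hd : (maximalIdeal S₀).spanFinrank = 3 := by
    have h := IsRegularLocalRing.spanFinrank_maximalIdeal (R := S₀)
    rw [hdim₀] at h
    exact_mod_cast h
  have hX2 : X ∉ maximalIdeal S₀ ^ 2 := IsQuadraticTransform.chart_not_mem_sq hB hdom hX0
  obtain ⟨z, hz, hzX⟩ := ChartZero.exists_rsop_apply_eq hd hX hX2 (0 : Fin 3)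
  subst hzX
  have hzm : ∀ j, z j ∈ maximalIdeal S₀ := fun j => hz ▸ Ideal.subset_span ⟨j, rfl⟩
  have hX0L : ((z 0 : S₀) : L) ≠ 0 := fun h => hX0 (Subtype.ext h)
  have hzv : ![z 0, z 1, z 2] = z := by ext i; fin_cases i <;> rfl
  have hXYZ : Ideal.span {z 0, z 1, z 2} = maximalIdeal S₀ := by
    rw [← LemmaI.span_range_vec3, hzv, hz]
  /- ### Step 2: the chart map `Θ : B = S₀[𝔪₀/X] → κ₀[T, U]`, `Y/X ↦ T`, `Z/X ↦ U`, kernel `(X)` (prelims). -/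
  obtain ⟨Θ, hΘs, hΘk, hΘC, hΘt', hΘu'⟩ := exists_chart_fin_two S₀ hd z hz hX0
  set Xb : blowupRing S₀ ((z 0 : S₀) : L) := ⟨((z 0 : S₀) : L), le_blowupRing S₀ _ (z 0).2⟩ with hXb
  set tb : blowupRing S₀ ((z 0 : S₀) : L) := ⟨((z 1 : S₀) : L) / ((z 0 : S₀) : L), div_mem_blowupRing _ (hzm 1)⟩ with htb
  set ub : blowupRing S₀ ((z 0 : S₀) : L) := ⟨((z 2 : S₀) : L) / ((z 0 : S₀) : L), div_mem_blowupRing _ (hzm 2)⟩ with hub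
  set ι₀ : S₀ →+* blowupRing S₀ ((z 0 : S₀) : L) := Subring.inclusion (le_blowupRing S₀ ((z 0 : S₀) : L)) with hι₀
  letI := (Subring.inclusion hB).toAlgebra
  have hincl : ∀ s : S₀, algebraMap _ S₁ (ι₀ s) = Subring.inclusion h₀₁ s := fun _ => rfl
  have hXb' : algebraMap _ S₁ Xb = Subring.inclusion h₀₁ (z 0) := rfl
  have hX'm : Subring.inclusion h₀₁ (z 0) ∈ maximalIdeal S₁ := (LemmaI.inclusion_mem_maximalIdeal_iff hdom (z 0)).mpr hX
  have hdom' : ∀ m : S₀, m ∈ maximalIdeal S₀ → Subring.inclusion h₀₁ m ∈ maximalIdeal S₁ := fun m hm =>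
    (LemmaI.inclusion_mem_maximalIdeal_iff hdom m).mpr hm
  have hinj : Function.Injective (algebraMap (blowupRing S₀ ((z 0 : S₀) : L)) S₁) := Subring.inclusion_injective hB
  have hΘt : Θ tb = X 0 := hΘt' _
  have hΘu : Θ ub = X 1 := hΘu' _
  /- ### Step 3: `S₁ = B_𝔮`. -/
  haveI hloc : IsLocalization.AtPrime S₁ ((maximalIdeal S₁).comap (algebraMap (blowupRing S₀ ((z 0 : S₀) : L)) S₁)) :=
    ClaimR.isLocalizationAtPrime_of_isQuadraticTransform hQT hX hX0 hB
  set 𝔮 : Ideal (blowupRing S₀ ((z 0 : S₀) : L)) := (maximalIdeal S₁).comap (algebraMap (blowupRing S₀ ((z 0 : S₀) : L)) S₁)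
    with h𝔮def
  have hXb𝔮 : Xb ∈ 𝔮 := by rw [h𝔮def, Ideal.mem_comap, hXb']; exact hX'm
  /- ### Step 4: the point `𝔫 = Θ(𝔮)` of the exceptional plane; `κ(𝔫)` is finite over `κ₀`. -/
  set 𝔫 : Ideal (MvPolynomial (Fin 2) (ResidueField S₀)) := 𝔮.map Θ with h𝔫def
  have h𝔫 : 𝔫.comap Θ = 𝔮 := by
    rw [h𝔫def, Ideal.comap_map_of_surjective _ hΘs, sup_eq_left, ← RingHom.ker_eq_comap_bot, hΘk,
      Ideal.span_le, Set.singleton_subset_iff]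
    exact hXb𝔮
  have hq3 : 𝔮.height = (2 : ℕ) + 1 := by
    have h := IsLocalization.AtPrime.ringKrullDim_eq_height 𝔮 S₁
    rw [hdim₁] at h
    have h3 : ((𝔮.height : ℕ∞) : WithBot ℕ∞) = ((3 : ℕ∞) : WithBot ℕ∞) := h.symm
    rw [WithBot.coe_injective h3]
    show (3 : ℕ∞) = (2 : ℕ) + 1
    norm_num
  obtain ⟨hA2, hAfin⟩ := ClaimR.ringKrullDim_mvPolynomial_fin_two (ResidueField S₀)
  haveI := hAfin
  haveI : IsNoetherianRing (blowupRing S₀ ((z 0 : S₀) : L)) := ClaimR.isNoetherianRing_blowupRing S₀ _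
  haveI h𝔫max : 𝔫.IsMaximal := ClaimR.isMaximal_map_of_height 𝔮 Θ hΘs hΘk hXb𝔮 hA2 hq3
  letI := Ideal.Quotient.field 𝔫
  haveI : Module.Finite (ResidueField S₀) (MvPolynomial (Fin 2) (ResidueField S₀) ⧸ 𝔫) :=
    finite_of_finite_type_of_isJacobsonRing (ResidueField S₀) _
  /- ### Step 5: `q ≤ [κ(𝔫) : κ₀]` from the `𝔪`-independent family `u`. -/
  have hq : q ≤ finrank (ResidueField S₀) (MvPolynomial (Fin 2) (ResidueField S₀) ⧸ 𝔫) :=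
    card_le_finrank_of_indep (S := S₁) 𝔮 Θ h𝔫 ι₀ (residue S₀) Ideal.Quotient.mk_surjective
      (fun a => residue_eq_zero_iff a) (fun a => by rw [hΘC, MvPolynomial.algebraMap_eq]) u hindep
  /- ### Step 6: `x₀S₁ = 𝔪₀S₁ = XS₁`: `X' = v x₀`, `x₀ = v' X'`, `v v' = 1`. -/
  set X' : S₁ := Subring.inclusion h₀₁ (z 0) with hX'def
  have hX'0 : X' ≠ 0 := fun e => hX0L (congrArg Subtype.val e)
  have hdimX : ringKrullDim (S₁ ⧸ Ideal.span ({X'} : Set S₁)) + 1 = 3 := by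
    rw [← hdim₁]
    exact ringKrullDim_quotient_span_singleton_succ_eq_ringKrullDim_of_mem_nonZeroDivisors
      (mem_nonZeroDivisors_of_ne_zero hX'0) hX'm
  have hspan : Ideal.span ({x₀} : Set S₁) = Ideal.span {X'} := by
    rw [← hx₀]
    apply le_antisymm
    · rw [Ideal.span_le]
      rintro _ ⟨y, hy, rfl⟩
      exact LemmaI.inclusion_mem_span_exc h₀₁ hB hX0L hy
    · rw [Ideal.span_le, Set.singleton_subset_iff]
      exact Ideal.subset_span ⟨z 0, hzm 0, rfl⟩
  obtain ⟨v, v', hv, hv', hvv'⟩ := exists_mul_eq_of_span_singleton_eq hspan hX'0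
  -- `hv : v * x₀ = X'`, `hv' : v' * X' = x₀`
  have hv'v : v' * v = 1 := by rw [mul_comm]; exact hvv'
  have hvu : IsUnit v := IsUnit.of_mul_eq_one v' hvv'
  /- ### Step 7: the forms `Φ` (`F = f₀ − g₀² ∈ 𝔪₀^d`) and `Φ_G` (`G ∈ 𝔪₀^δ`) and their chart readings `Fb`, `wB ∈ B`. -/
  have hFmem : f₀ - g₀ ^ 2 ∈ maximalIdeal S₀ ^ d :=
    CleaningOptimal.mem_pow_of_quadraticTransform hreg₀ hQT h₀₁ x₀ hx₀ (y := f₀ - g₀ ^ 2) (a := f₁) (n := d)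
      (by push_cast; linear_combination -hlaw)
  obtain ⟨Φ, hΦ, hΦF⟩ := LemmaI.exists_form_eval_eq hXYZ hFmem
  obtain ⟨ΦG, hΦG, hΦGG⟩ := LemmaI.exists_form_eval_eq hXYZ hGδ
  set g : Fin 3 → blowupRing S₀ ((z 0 : S₀) : L) := ![1, tb, ub] with hgdef
  set Fb : blowupRing S₀ ((z 0 : S₀) : L) := MvPolynomial.eval₂ ι₀ g Φ with hFbdef
  set wB : blowupRing S₀ ((z 0 : S₀) : L) := MvPolynomial.eval₂ ι₀ g ΦG with hwBdef
  have ht₁ : algebraMap _ S₁ tb * Subring.inclusion h₀₁ (z 0) = Subring.inclusion h₀₁ (z 1) :=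
    Subtype.ext (div_mul_cancel₀ ((z 1 : S₀) : L) hX0L)
  have hu₁ : algebraMap _ S₁ ub * Subring.inclusion h₀₁ (z 0) = Subring.inclusion h₀₁ (z 2) :=
    Subtype.ext (div_mul_cancel₀ ((z 2 : S₀) : L) hX0L)
  have hcompι : (algebraMap (blowupRing S₀ ((z 0 : S₀) : L)) S₁).comp ι₀ = Subring.inclusion h₀₁ :=
    RingHom.ext fun _ => rfl
  have hcompg : (algebraMap (blowupRing S₀ ((z 0 : S₀) : L)) S₁) ∘ g = ![1, algebraMap _ S₁ tb, algebraMap _ S₁ ub] := by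
    funext i; fin_cases i
    · exact map_one _
    · rfl
    · rfl
  have hFbS : algebraMap _ S₁ Fb = f₁ * v' ^ d := by
    have hF₁ : (f₁ * v' ^ d) * Subring.inclusion h₀₁ (z 0) ^ d = Subring.inclusion h₀₁ (MvPolynomial.eval ![z 0, z 1, z 2] Φ) := by
      rw [hΦF, mul_assoc, ← mul_pow, ← hX'def, hv']
      exact Subtype.ext (by push_cast [Subring.coe_inclusion]; linear_combination hlaw)
    rw [LemmaI.eq_eval₂_chart h₀₁ hX0L (algebraMap _ S₁ tb) (algebraMap _ S₁ ub) ht₁ hu₁ hΦ hF₁, hFbdef,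
      MvPolynomial.eval₂_comp_left (algebraMap _ S₁) ι₀ g Φ, hcompι, hcompg]
  have hwBS : algebraMap _ S₁ wB = w * v' ^ δ := by
    have hG₁ : (w * v' ^ δ) * Subring.inclusion h₀₁ (z 0) ^ δ = Subring.inclusion h₀₁ (MvPolynomial.eval ![z 0, z 1, z 2] ΦG) := by
      rw [hΦGG, mul_assoc, ← mul_pow, ← hX'def, hv']
      exact Subtype.ext (by push_cast [Subring.coe_inclusion]; linear_combination -hGw)
    rw [LemmaI.eq_eval₂_chart h₀₁ hX0L (algebraMap _ S₁ tb) (algebraMap _ S₁ ub) ht₁ hu₁ hΦG hG₁, hwBdef,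
      MvPolynomial.eval₂_comp_left (algebraMap _ S₁) ι₀ g ΦG, hcompι, hcompg]
  have hf₁ : f₁ = algebraMap _ S₁ Fb * v ^ d := by
    rw [hFbS, mul_assoc, ← mul_pow, hv'v, one_pow, mul_one]
  have hw : w = algebraMap _ S₁ wB * v ^ δ := by
    rw [hwBS, mul_assoc, ← mul_pow, hv'v, one_pow, mul_one]
  -- readings through `Θ`
  have hΘg : (Θ : _ → MvPolynomial (Fin 2) (ResidueField S₀)) ∘ g = ![1, X 0, X 1] := by
    funext i; fin_cases i
    · exact map_one _
    · exact hΘt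
    · exact hΘu
  have hΘread : ∀ (Ψ : MvPolynomial (Fin 3) S₀), Θ (MvPolynomial.eval₂ ι₀ g Ψ) =
      ∑ β ∈ Ψ.support, C (residue S₀ (coeff β Ψ)) * X 0 ^ (β 1) * X 1 ^ (β 2) := by
    intro Ψ
    rw [MvPolynomial.eval₂_comp_left Θ ι₀ g Ψ, hΘg, eval₂_one_cons_eq_sum]
    simp only [RingHom.comp_apply, hΘC]
  have hPdeg : (Θ Fb).totalDegree ≤ d := by
    rw [hFbdef, hΘread Φ]; exact totalDegree_chartReading_le _ hΦ
  have hdegh : (Θ wB).totalDegree ≤ δ := by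
    rw [hwBdef, hΘread ΦG]; exact totalDegree_chartReading_le _ hΦG
  have hFbsum : Fb = ∑ β ∈ Φ.support, ι₀ (coeff β Φ) * tb ^ (β 1) * ub ^ (β 2) := by
    rw [hFbdef, hgdef]; exact eval₂_one_cons_eq_sum ι₀ tb ub Φ
  have hsupp : ∀ β ∈ Φ.support, β 1 + β 2 ≤ d := by
    intro β hβ
    have hdeg : β.degree = d := LemmaI.degree_eq_of_coeff_ne_zero hΦ (mem_support_iff.mp hβ)
    rw [← hdeg, Finsupp.degree_eq_sum, Fin.sum_univ_three]; omega
  /- ### Step 8: the prime `𝔭 = Θ((x₀, w)S₁ ∩ B) ∋ h := Θ(wB)`, `h ≠ 0`, `𝔭 ≤ 𝔫`. -/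
  set P₁ : Ideal S₁ := Ideal.span ({x₀, w} : Set S₁) with hP₁
  have hP₁le : P₁ ≤ maximalIdeal S₁ := IsLocalRing.le_maximalIdeal hWp.ne_top
  have hx₀m : x₀ ∈ maximalIdeal S₁ := hP₁le (Ideal.subset_span (by simp))
  have hwm : w ∈ maximalIdeal S₁ := hP₁le (Ideal.subset_span (by simp))
  set 𝔭B : Ideal (blowupRing S₀ ((z 0 : S₀) : L)) := P₁.comap (algebraMap _ S₁) with h𝔭B
  set 𝔭 : Ideal (MvPolynomial (Fin 2) (ResidueField S₀)) := 𝔭B.map Θ with h𝔭def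
  have hX'P₁ : X' ∈ P₁ := by rw [← hv]; exact P₁.mul_mem_left v (Ideal.subset_span (by simp))
  have hXb𝔭B : Xb ∈ 𝔭B := by rw [h𝔭B, Ideal.mem_comap, hXb']; exact hX'P₁
  haveI h𝔭p : 𝔭.IsPrime := Ideal.map_isPrime_of_surjective hΘs (by rw [hΘk, Ideal.span_singleton_le_iff_mem]; exact hXb𝔭B)
  have h𝔭𝔫 : 𝔭 ≤ 𝔫 := Ideal.map_mono (Ideal.comap_mono hP₁le)
  have hwB𝔭B : wB ∈ 𝔭B := by
    rw [h𝔭B, Ideal.mem_comap, hwBS]; exact P₁.mul_mem_right _ (Ideal.subset_span (by simp))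
  have hh𝔭 : Θ wB ∈ 𝔭 := Ideal.mem_map_of_mem Θ hwB𝔭B
  have hh0 : Θ wB ≠ 0 := by
    intro h0
    have h1 : wB ∈ RingHom.ker Θ := h0
    rw [hΘk, Ideal.mem_span_singleton'] at h1
    obtain ⟨c, hc⟩ := h1
    refine not_mem_span_singleton_of_ringKrullDim hspan hWdim hdimX ?_
    rw [hw, ← hc, map_mul, hXb']
    exact Ideal.mul_mem_right _ _ (Ideal.mul_mem_left _ _ (Ideal.mem_span_singleton_self _))
  /- ### Step 9: the clean datum read in `B`: `s² Fb = b² + b'`, `s ∉ 𝔮`, `b' ∈ 𝔮^d`. -/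
  obtain ⟨m, hm⟩ := hev
  obtain ⟨g₁, hg₁⟩ := hclean
  have hmem𝔮 : ∀ c : blowupRing S₀ ((z 0 : S₀) : L), c ∈ 𝔮 ↔ algebraMap _ S₁ c ∈ maximalIdeal S₁ := fun c => Ideal.mem_comap
  obtain ⟨s, b, b', hs𝔮, hsF, hb'⟩ := exists_clean_reading (S := S₁) 𝔮 hmem𝔮 hinj hm hvu hf₁ hg₁
  have hsM : Θ s ∉ 𝔫 := by rwa [← Ideal.mem_comap, h𝔫]
  have hcleanM : Θ s ^ 2 * Θ Fb - Θ b ^ 2 ∈ 𝔫 ^ d := by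
    have h1 : Θ (s ^ 2 * Fb - b ^ 2) ∈ 𝔫 ^ d := by
      rw [h𝔫def, ← Ideal.map_pow]
      apply Ideal.mem_map_of_mem
      rw [hsF, add_sub_cancel_left]; exact hb'
    simpa using h1
  /- ### Step 10: inequalities. -/
  have hineqG : δ * (d + 1) < (d - 1) * finrank (ResidueField S₀) (MvPolynomial (Fin 2) (ResidueField S₀) ⧸ 𝔫) :=
    lt_of_lt_of_le hstar (by rw [mul_comm]; exact Nat.mul_le_mul_left _ hq)
  have hineqF : δ * d < (d - 1) * finrank (ResidueField S₀) (MvPolynomial (Fin 2) (ResidueField S₀) ⧸ 𝔫) :=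
    lt_of_le_of_lt (Nat.mul_le_mul_left _ (Nat.le_succ d)) hineqG
  /- ### Step 11: the regular system `(x₀, w, t)` of `S₁` and the Cohen frame `Ŝ₁ ≃ K'⟦X₀, X₁, X₂⟧`. -/
  obtain ⟨t, ht𝔪⟩ := exists_span_triple_eq_maximalIdeal x₀ w hWreg hWdim hx₀m hwm
  haveI : Fact (Nat.Prime 2) := ⟨Nat.prime_two⟩
  obtain ⟨σ₁, frame, -, hframeX, -, -⟩ := NestedFrames.exists_frame_with_section 2 hdim₁ ![x₀, w, t] ht𝔪
  set Sh := AdicCompletion (maximalIdeal S₁) S₁ with hShdef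
  set K' := ResidueField (AdicCompletion (maximalIdeal S₁) S₁) with hK'def
  set A := MvPowerSeries (Fin 3) K' with hAdef
  set ι₁ : S₁ →+* Sh := algebraMap S₁ Sh with hι₁def
  haveI hSh2 : CharP Sh 2 := RadicandCohenFrame.charP_adicCompletion 2 S₁
  haveI hShreg : IsRegularLocalRing Sh := isRegularLocalRing_adicCompletion S₁
  haveI hA2 : CharP A 2 := charP_of_injective_ringHom (f := frame.toRingHom) frame.injective 2
  have hfx₀ : frame (ι₁ x₀) = MvPowerSeries.X 0 := hframeX 0
  have hfw : frame (ι₁ w) = MvPowerSeries.X 1 := hframeX 1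
  set ψ : blowupRing S₀ ((z 0 : S₀) : L) →+* A := frame.toRingHom.comp (ι₁.comp (algebraMap _ S₁)) with hψdef
  have hψ : ∀ c, ψ c = frame (ι₁ (algebraMap _ S₁ c)) := fun _ => rfl
  set π : A →+* A ⧸ Ideal.span ({MvPowerSeries.X 0} : Set A) := Ideal.Quotient.mk _ with hπdef
  have hψXb : ψ Xb = MvPowerSeries.X 0 * frame (ι₁ v) := by
    rw [hψ, hXb', ← hv, map_mul, map_mul, hfx₀, mul_comm]
  have hπψXb : π (ψ Xb) = 0 := by
    rw [hψXb, hπdef, Ideal.Quotient.eq_zero_iff_mem]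
    exact Ideal.mul_mem_right _ _ (Ideal.mem_span_singleton_self _)
  have hkerle : RingHom.ker Θ ≤ RingHom.ker (π.comp ψ) := by
    rw [hΘk, Ideal.span_singleton_le_iff_mem, RingHom.mem_ker, RingHom.comp_apply]; exact hπψXb
  set ε : MvPolynomial (Fin 2) (ResidueField S₀) →+* A ⧸ Ideal.span ({MvPowerSeries.X 0} : Set A) :=
    Θ.liftOfSurjective hΘs ⟨π.comp ψ, hkerle⟩ with hεdef
  have hε : ∀ c, ε (Θ c) = π (ψ c) := fun c => Θ.liftOfRightInverse_comp_apply _ _ ⟨π.comp ψ, hkerle⟩ c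
  have hι𝔪 : ∀ a ∈ maximalIdeal S₁, ι₁ a ∈ maximalIdeal Sh := fun a ha => by
    have h := (CompletionTransfer.mem_maximalIdeal_pow_iff_adicCompletion a 1).mp (by rw [pow_one]; exact ha)
    rwa [pow_one] at h
  have hQ : ∀ c ∈ 𝔮, ψ c ∈ maximalIdeal A := by
    intro c hc
    have h := CampaignW46.FormalChart.ringEquiv_mem_maximalIdeal_pow frame (k := 1)
      (by rw [pow_one]; exact hι𝔪 _ ((hmem𝔮 c).mp hc))
    rwa [pow_one] at h
  have hsu : IsUnit (ψ s) := by
    have hsuS : IsUnit (algebraMap _ S₁ s) := by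
      by_contra hns
      exact hs𝔮 ((hmem𝔮 s).mpr ((mem_maximalIdeal _).mpr (mem_nonunits_iff.mpr hns)))
    rw [hψ]
    exact (hsuS.map ι₁).map frame
  /- ### Step 12: contraction `π ψ(b) ∈ π(𝔪_A^n) ⇒ Θ b ∈ 𝔫^n` (FILE D with the density/contraction clauses of `S₁ → Ŝ₁`). -/
  have hdense : ∀ (n : ℕ) (t' : Sh), ∃ a : S₁, t' - ι₁ a ∈ maximalIdeal Sh ^ n := fun n t' =>
    CompletionTransfer.exists_sub_algebraMap_mem_pow t' n
  have hcontrS : ∀ (n : ℕ) (a : S₁), ι₁ a ∈ maximalIdeal Sh ^ n → a ∈ maximalIdeal S₁ ^ n := fun n a h =>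
    (CompletionTransfer.mem_maximalIdeal_pow_iff_adicCompletion a n).mpr h
  have hvv'A : frame (ι₁ v) * frame (ι₁ v') = 1 := by rw [← map_mul, ← map_mul, hvv', map_one, map_one]
  have hcontr : ∀ (n : ℕ) (c : blowupRing S₀ ((z 0 : S₀) : L)), π (ψ c) ∈ Ideal.map π (maximalIdeal A ^ n) → Θ c ∈ 𝔫 ^ n := by
    intro n c hc
    obtain ⟨a, ha, hπa⟩ := (Ideal.mem_map_iff_of_surjective π Ideal.Quotient.mk_surjective).mp hc
    have h1 : ψ c - a ∈ Ideal.span ({MvPowerSeries.X 0} : Set A) := by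
      rw [← Ideal.Quotient.eq]; exact hπa.symm
    obtain ⟨e, he⟩ := Ideal.mem_span_singleton'.mp h1
    -- `he : e * X 0 = ψ c - a`; pull back along `frame.symm`
    have h2 : ι₁ (algebraMap _ S₁ c) - ι₁ (algebraMap _ S₁ Xb) * (ι₁ v' * frame.symm e) = frame.symm a := by
      apply frame.injective
      have h3 : frame (ι₁ (algebraMap _ S₁ c)) = ψ c := rfl
      have h4 : frame (ι₁ (algebraMap _ S₁ Xb)) = ψ Xb := rfl
      rw [map_sub, map_mul, map_mul, RingEquiv.apply_symm_apply, RingEquiv.apply_symm_apply, h3, h4, hψXb]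
      linear_combination -he - (MvPowerSeries.X 0 * e) * hvv'A
    refine apply_mem_pow_of_hat (S := S₁) (T := Sh) 𝔮 Θ hΘs h𝔫 hΘk ι₁ hdense hcontrS n c (ι₁ v' * frame.symm e) ?_
    rw [h2]
    exact CampaignW46.FormalChart.ringEquiv_mem_maximalIdeal_pow frame.symm ha
  /- ### Step 13: the transversal derivation `∂ = frame ∘ D₁ : B → A` (FILE E), `∂(X) = 1`, `∂(T) = ∂(U) = 0`. -/
  obtain ⟨D₁, hD₁add, hD₁mul, hD₁X, hD₁t, hD₁u, hD₁res⟩ := exists_transversal_derivation h₀₁ hreg₀ hdim₀ hXYZ hX0L (hzm 1) (hzm 2)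
    hB hdom' (ι₁.comp (algebraMap _ S₁)) (fun _ => rfl)
  set D : blowupRing S₀ ((z 0 : S₀) : L) → A := fun c => frame (D₁ c) with hDdef
  have hDadd : ∀ a b, D (a + b) = D a + D b := fun a b => by simp only [hDdef, hD₁add, map_add]
  have hDmul : ∀ a b, D (a * b) = ψ a * D b + ψ b * D a := fun a b => by
    simp only [hDdef, hD₁mul, map_add, map_mul]; rfl
  have hDXb : D Xb = 1 := by simp only [hDdef]; rw [hXb, hD₁X, map_one]
  have hDt : D tb = 0 := by simp only [hDdef]; rw [htb, hD₁t, map_zero]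
  have hDu : D ub = 0 := by simp only [hDdef]; rw [hub, hD₁u, map_zero]
  have hmapx₀ : Ideal.map ((frame.toRingHom.comp ι₁).comp (Subring.inclusion h₀₁)) (maximalIdeal S₀) =
      Ideal.span ({MvPowerSeries.X 0} : Set A) := by
    rw [← Ideal.map_map, show (maximalIdeal S₀).map (Subring.inclusion h₀₁) = Ideal.span {x₀} from hx₀, Ideal.map_span,
      Set.image_singleton]
    simp only [RingHom.coe_comp, Function.comp_apply, RingEquiv.toRingHom_eq_coe, RingEquiv.coe_toRingHom, hfx₀]
    rfl
  have hres : ∀ c : S₀, ∃ s₀ s₁' s₂' : S₀, π (D (ι₀ c)) = π (ψ (ι₀ s₀ + ι₀ s₁' * tb + ι₀ s₂' * ub)) := by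
    intro c
    obtain ⟨s₀, s₁', s₂', hc⟩ := hD₁res c
    refine ⟨s₀, s₁', s₂', ?_⟩
    rw [hπdef, Ideal.Quotient.eq, ← hmapx₀]
    have h1 := Ideal.mem_map_of_mem frame.toRingHom hc
    rw [Ideal.map_map, map_sub] at h1
    exact h1
  /- ### Step 14: `𝔭.map ε ≤ π((X₀, X₁))`. -/
  have hP₁A : P₁.map (frame.toRingHom.comp ι₁) = Ideal.span ({MvPowerSeries.X 0, MvPowerSeries.X 1} : Set A) := by
    rw [hP₁, Ideal.map_span, Set.image_pair]
    simp only [RingHom.coe_comp, Function.comp_apply, RingEquiv.toRingHom_eq_coe, RingEquiv.coe_toRingHom, hfx₀, hfw]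
    rfl
  have hψ𝔭B : 𝔭B.map ψ ≤ Ideal.span ({MvPowerSeries.X 0, MvPowerSeries.X 1} : Set A) := by
    rw [Ideal.map_le_iff_le_comap]
    intro c hc
    rw [Ideal.mem_comap, ← hP₁A, hψ]
    exact Ideal.mem_map_of_mem (frame.toRingHom.comp ι₁) (Ideal.mem_comap.mp hc)
  have h𝔭ε : 𝔭.map ε ≤ (Ideal.span ({MvPowerSeries.X 0, MvPowerSeries.X 1} : Set A)).map π := by
    rw [h𝔭def, Ideal.map_map, show ε.comp Θ = π.comp ψ from RingHom.ext hε, ← Ideal.map_map]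
    exact Ideal.map_mono hψ𝔭B
  /- ### Step 15: the transversal reading (FILE G): `π ∂(Fb) ∈ 𝔭.map ε`. -/
  have h2A : (2 : A) = 0 := by
    have h := CharP.cast_eq_zero A 2
    exact_mod_cast h
  have hT : π (D Fb) ∈ 𝔭.map ε :=
    transversal_apply_mem h2A ι₀ (residue S₀) Θ hΘC hΘt hΘu ψ π ε hε 𝔫 𝔭 h𝔭𝔫 hcontr hh𝔭 hh0 hdegh hineqG Φ.support
      (fun β => coeff β Φ) (fun β => β 1) (fun β => β 2) hsupp hFbsum 𝔮 hQ hsu hb' hsF D hDadd hDmul hDt hDu hres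
  haveI hκ2 : CharP (ResidueField S₀) 2 :=
    (CharP.charP_iff_prime_eq_zero Nat.prime_two).mpr (by rw [← map_natCast (residue S₀) 2, CharP.cast_eq_zero, map_zero])
  /- ### Step 16: the all-derivations test: `Δ(ψ Fb) ∈ (X₀, X₁)` for every derivation `Δ` of `A` (FILE F on `Δ − Δ(X)∂`). -/
  have hall : ∀ Δ : Derivation ℤ A A, Δ (ψ Fb) ∈ Ideal.span ({MvPowerSeries.X 0, MvPowerSeries.X 1} : Set A) := by
    intro Δ
    set Δ' : blowupRing S₀ ((z 0 : S₀) : L) → A := fun c => Δ (ψ c) - Δ (ψ Xb) * D c with hΔ'def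
    have hΔ'add : ∀ a b, Δ' (a + b) = Δ' a + Δ' b := fun a b => by
      simp only [hΔ'def, map_add, hDadd]; ring
    have hΔ'mul : ∀ a b, Δ' (a * b) = ψ a * Δ' b + ψ b * Δ' a := fun a b => by
      simp only [hΔ'def, map_mul, Derivation.leibniz, smul_eq_mul, hDmul]; ring
    have hΔ'X : π (Δ' Xb) = 0 := by simp only [hΔ'def, hDXb, mul_one, sub_self, map_zero]
    have hV : π (Δ' Fb) ∈ 𝔭.map ε :=
      vertical_apply_mem Θ hΘs hΘk ψ π ε hε 𝔫 𝔭 h𝔭𝔫 hPdeg hsM hcleanM hh𝔭 hh0 hdegh hineqF rfl Δ' hΔ'add hΔ'mul hΔ'X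
    have hsum : π (Δ (ψ Fb)) = π (Δ' Fb) + π (Δ (ψ Xb)) * π (D Fb) := by
      simp only [hΔ'def, map_sub, map_mul]; ring
    have hmem : π (Δ (ψ Fb)) ∈ 𝔭.map ε := by
      rw [hsum]; exact Ideal.add_mem _ hV (Ideal.mul_mem_left _ _ hT)
    have h3 : Δ (ψ Fb) ∈ Ideal.span ({MvPowerSeries.X 0, MvPowerSeries.X 1} : Set A) ⊔ Ideal.span {MvPowerSeries.X 0} :=
      Ideal.mem_quotient_iff_mem_sup.mp (h𝔭ε hmem)
    rwa [sup_eq_left.mpr ((Ideal.span_singleton_le_iff_mem _).mpr (Ideal.subset_span (by simp)))] at h3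
  /- ### Steps 17–18: `f̂₁ = ψ(Fb)·û^d` with `d` even; formal square root (FILE C), persistent arc, excellent descent (prelims). -/
  have hFA : frame (ι₁ f₁) = ψ Fb * frame (ι₁ v) ^ d := by rw [hf₁, map_mul, map_mul, map_pow, map_pow, hψ]
  exact not_hasIsolatedSingularity_of_forall_derivation S₁ hreg₁ hexc hdim₁ hx₀m hwm frame hfx₀ hfw f₁ v (ψ Fb) ⟨m, hm⟩ hFA hall

end Summit.ResolutionOfSingularities.ResolutionOfSingularities.Theorems.SwitchingDichotomy.LemmaI2

end
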